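import Mathlib
import HarnessLib
import Literature.NumberTheory.LFunctions.ZetaScrewSeriesProofs

/-!
# Route `IntegerScrew`, LINE «SCREW DEPTH–HEIGHT DICTIONARY» (rh-idea-10/A) — the unconditional
# ZERO-SIDE FORM of the screw quadratic form (item `stmt-RiemannHypothesis-21805`, `ScrewZeroSideForm`)

For every `M` and every real vector `x`, the real quadratic form of Suzuki's screw kernel
`K(t,u) = Ψ(t) + Ψ(u) − Ψ(t − u)` (`zetaScrewKernel`) on the nodes `log 2, …, log M` is a convergent
sum over the distinct non-trivial zeros `ρ` of `ζ` (multiplicity `m_ρ = riemannZetaZeroOrder ρ`):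

  `x·S_M·x = Σ_{m,m'} K(log m, log m') x_m x_{m'} = −Σ_ρ m_ρ · A_x(ρ − ½)·A_x(½ − ρ)/(ρ − ½)²`,
  `A_x(w) = Σ_{2 ≤ m ≤ M} x_m (1 − m^w)`,

as a `HasSum` over the subtype of non-trivial zeros — no Riemann hypothesis, no symmetry of the zero
set is used.  PROOF: termwise from Suzuki's series `Ψ(t) = Σ_ρ m_ρ (cosh((ρ−½)t) − 1)/(ρ−½)²`
(`Suzuki2023_thm11_series_holds`, PROVED in the tree) at `t = log m, log m', log m − log m'`, finite
linear combinations of `HasSum`s, and the finite algebraic identity (`sum_mul_sum_eq_neg_sum_sum`)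

  `(Σ_m x_m(1 − P_m))(Σ_{m'} x_{m'}(1 − Q_{m'}))
     = −Σ_{m,m'} x_m x_{m'} [((P_m+Q_m)/2 − 1) + ((P_{m'}+Q_{m'})/2 − 1) − ((P_m Q_{m'} + Q_m P_{m'})/2 − 1)]`

(symmetrise the double sum under `m ↔ m'`), applied with `P_m = e^{w log m} = m^w`, `Q_m = e^{−w log m}
= m^{−w}`, `w = ρ − ½`, so that the brackets are `cosh(w log m) − 1`, `cosh(w log m') − 1`,
`cosh(w(log m − log m')) − 1`.

This is the dictionary image of the function-field moment identity (`PfPersistenceFfWeilCriterion`);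
it documents the full quadratic-form version of the detection crux of the line.  RH is NOT proved by
this file and nothing here bears on the truth of RH.  Reference: M. Suzuki, *J. Lond. Math. Soc.* (2)
108 (2023) 1448–1487, Thm 1.1 (2) [Suzuki2023].
-/

noncomputable section

-- D-0017: `Summit.<S>.<S>.…` is the designed namespace of a single-problem summit.
set_option linter.dupNamespace false

namespace Summit.RiemannHypothesis.RiemannHypothesis.Theorems.IntegerScrew

open Finset Literature.NumberTheory.LFunctions

/-- The finite symmetrisation identity behind the zero-side form: for any coefficients `x` and any
`P, Q`, `(Σ x_m(1 − P_m))(Σ x_{m'}(1 − Q_{m'}))` equals minus the double sum of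
`x_m x_{m'}·[((P_m+Q_m)/2 − 1) + ((P_{m'}+Q_{m'})/2 − 1) − ((P_m Q_{m'} + Q_m P_{m'})/2 − 1)]`
(average the expanded double sum with its `m ↔ m'` copy). -/
theorem sum_mul_sum_eq_neg_sum_sum (s : Finset ℕ) (x P Q : ℕ → ℂ) :
    (∑ m ∈ s, x m * (1 - P m)) * (∑ m ∈ s, x m * (1 - Q m)) =
      -∑ m ∈ s, ∑ m' ∈ s, x m * x m' *
        ((((P m + Q m) / 2 - 1) + ((P m' + Q m') / 2 - 1)) -
          ((P m * Q m' + Q m * P m') / 2 - 1)) := by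
  have hsymm : ∑ m ∈ s, ∑ m' ∈ s, x m * x m' * ((1 - Q m) * (1 - P m')) =
      ∑ m ∈ s, ∑ m' ∈ s, x m * x m' * ((1 - P m) * (1 - Q m')) := by
    rw [Finset.sum_comm]
    exact Finset.sum_congr rfl fun m _ => Finset.sum_congr rfl fun m' _ => by ring
  have hL : (∑ m ∈ s, x m * (1 - P m)) * (∑ m ∈ s, x m * (1 - Q m)) =
      ∑ m ∈ s, ∑ m' ∈ s, x m * x m' * ((1 - P m) * (1 - Q m')) := by
    rw [Finset.sum_mul_sum]
    exact Finset.sum_congr rfl fun m _ => Finset.sum_congr rfl fun m' _ => by ring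
  have hR : -∑ m ∈ s, ∑ m' ∈ s, x m * x m' *
        ((((P m + Q m) / 2 - 1) + ((P m' + Q m') / 2 - 1)) -
          ((P m * Q m' + Q m * P m') / 2 - 1)) =
      (1 / 2) * ∑ m ∈ s, ∑ m' ∈ s, x m * x m' * ((1 - P m) * (1 - Q m')) +
        (1 / 2) * ∑ m ∈ s, ∑ m' ∈ s, x m * x m' * ((1 - Q m) * (1 - P m')) := by
    rw [Finset.mul_sum, Finset.mul_sum, ← Finset.sum_add_distrib, ← Finset.sum_neg_distrib]
    refine Finset.sum_congr rfl fun m _ => ?_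
    rw [Finset.mul_sum, Finset.mul_sum, ← Finset.sum_add_distrib, ← Finset.sum_neg_distrib]
    exact Finset.sum_congr rfl fun m' _ => by ring
  rw [hL, hR, hsymm]
  ring

/-- Pointwise (one zero `ρ`, `w = ρ − ½`) form of the dictionary: the summand of the item,
`−m_ρ·A_x(w)A_x(−w)/w²` with `A_x(±w)` written with complex powers `m^{±w}`, equals the double sum
over `(m, m')` of `x_m x_{m'}` times the combination of the three Suzuki summands
`m_ρ(cosh(w·t) − 1)/w²` at `t = log m, log m', log m − log m'`.  Only `m ≠ 0` on `s` is needed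
(principal branch `m^w = e^{w log m}`). -/
theorem neg_mul_screwSide_eq_sum_sum (s : Finset ℕ) (hs : ∀ m ∈ s, m ≠ 0) (x : ℕ → ℝ) (c ρ : ℂ) :
    -(c * ((∑ m ∈ s, (x m : ℂ) * (1 - (m : ℂ) ^ (ρ - 1 / 2))) *
        (∑ m ∈ s, (x m : ℂ) * (1 - (m : ℂ) ^ (1 / 2 - ρ))) / (ρ - 1 / 2) ^ 2)) =
      ∑ m ∈ s, ∑ m' ∈ s, ((x m * x m' : ℝ) : ℂ) *
        (c * ((Complex.cosh ((ρ - 1 / 2) * (Real.log m : ℝ)) - 1) / (ρ - 1 / 2) ^ 2) +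
          c * ((Complex.cosh ((ρ - 1 / 2) * (Real.log m' : ℝ)) - 1) / (ρ - 1 / 2) ^ 2) -
          c * ((Complex.cosh ((ρ - 1 / 2) * ((Real.log m - Real.log m' : ℝ) : ℂ)) - 1) /
            (ρ - 1 / 2) ^ 2)) := by
  set w : ℂ := ρ - 1 / 2 with hw
  have hw' : (1 / 2 - ρ) = -w := by rw [hw]; ring
  rw [hw']
  -- the exponentials `P_m = e^{w log m} = m^w`, `Q_m = e^{-w log m} = m^{-w}`
  set P : ℕ → ℂ := fun m => Complex.exp (w * (Real.log m : ℝ)) with hP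
  set Q : ℕ → ℂ := fun m => Complex.exp (-(w * (Real.log m : ℝ))) with hQ
  have hA : ∑ m ∈ s, (x m : ℂ) * (1 - (m : ℂ) ^ w) = ∑ m ∈ s, (x m : ℂ) * (1 - P m) := by
    refine Finset.sum_congr rfl fun m hm => ?_
    have hm0 : (m : ℂ) ≠ 0 := by exact_mod_cast hs m hm
    rw [Complex.cpow_def_of_ne_zero hm0, ← Complex.natCast_log, mul_comm _ w]
  have hB : ∑ m ∈ s, (x m : ℂ) * (1 - (m : ℂ) ^ (-w)) = ∑ m ∈ s, (x m : ℂ) * (1 - Q m) := by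
    refine Finset.sum_congr rfl fun m hm => ?_
    have hm0 : (m : ℂ) ≠ 0 := by exact_mod_cast hs m hm
    rw [Complex.cpow_def_of_ne_zero hm0, ← Complex.natCast_log, mul_neg, mul_comm _ w]
  have hcosh : ∀ z : ℂ, Complex.cosh z = (Complex.exp z + Complex.exp (-z)) / 2 := fun z => rfl
  have h1 : ∀ m : ℕ, Complex.cosh (w * (Real.log m : ℝ)) = (P m + Q m) / 2 := fun m => by
    rw [hcosh]
  have h3 : ∀ m m' : ℕ, Complex.cosh (w * ((Real.log m - Real.log m' : ℝ) : ℂ)) =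
      (P m * Q m' + Q m * P m') / 2 := fun m m' => by
    rw [hcosh, hP, hQ]
    simp only
    rw [← Complex.exp_add, ← Complex.exp_add]
    push_cast
    congr 1
    congr 1
    · congr 1; ring
    · congr 1; ring
  rw [hA, hB, sum_mul_sum_eq_neg_sum_sum]
  rw [neg_div, mul_neg, neg_neg, Finset.sum_div, Finset.mul_sum]
  refine Finset.sum_congr rfl fun m _ => ?_
  rw [Finset.sum_div, Finset.mul_sum]
  refine Finset.sum_congr rfl fun m' _ => ?_
  rw [h1, h1, h3]
  push_cast
  ring

/-- **Item `stmt-RiemannHypothesis-21805` (`IntegerScrew.ScrewZeroSideForm`), literally.**  For every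
`M` and real `x`, `Σ_{m,m' ∈ [2,M]} K(log m, log m')·x_m x_{m'} = −Σ_ρ m_ρ·A_x(ρ−½)A_x(½−ρ)/(ρ−½)²`
as a `HasSum` over the distinct non-trivial zeros of `ζ` (`A_x(w) = Σ x_m(1 − m^w)`), unconditionally.
Proof: three instances of `Suzuki2023_thm11_series_holds` per pair `(m, m')`, `HasSum.add/sub/mul_left`,
`hasSum_sum` over the finite index set, and the pointwise identity `neg_mul_screwSide_eq_sum_sum`.
RH is not proved by this; nothing here bears on the truth of RH. -/
theorem screwZeroSideForm : ∀ (M : ℕ) (x : ℕ → ℝ), HasSum (fun ρ : Literature.NumberTheory.LFunctions.ZetaZeros.riemannZetaNontrivialZeros => -((Literature.NumberTheory.LFunctions.riemannZetaZeroOrder (ρ : ℂ) : ℂ) * ((∑ m ∈ Finset.Icc 2 M, (x m : ℂ) * (1 - (m : ℂ) ^ ((ρ : ℂ) - 1 / 2))) * (∑ m ∈ Finset.Icc 2 M, (x m : ℂ) * (1 - (m : ℂ) ^ (1 / 2 - (ρ : ℂ)))) / ((ρ : ℂ) - 1 / 2) ^ 2))) ((∑ m ∈ Finset.Icc 2 M,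 ∑ m' ∈ Finset.Icc 2 M, Literature.NumberTheory.LFunctions.zetaScrewKernel (Real.log m) (Real.log m') * (x m * x m') : ℝ) : ℂ) := by
  intro M x
  set s : Finset ℕ := Finset.Icc 2 M with hs_def
  have hs : ∀ m ∈ s, m ≠ 0 := fun m hm => by
    rw [hs_def, Finset.mem_Icc] at hm
    omega
  have hser := Suzuki2023_thm11_series_holds
  -- one pair `(m, m')`: the kernel value as a sum over the zeros
  have hpair : ∀ m m' : ℕ, HasSum (fun ρ : ZetaZeros.riemannZetaNontrivialZeros =>
      ((x m * x m' : ℝ) : ℂ) *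
        ((riemannZetaZeroOrder (ρ : ℂ) : ℂ) *
            ((Complex.cosh (((ρ : ℂ) - 1 / 2) * (Real.log m : ℝ)) - 1) / ((ρ : ℂ) - 1 / 2) ^ 2) +
          (riemannZetaZeroOrder (ρ : ℂ) : ℂ) *
            ((Complex.cosh (((ρ : ℂ) - 1 / 2) * (Real.log m' : ℝ)) - 1) / ((ρ : ℂ) - 1 / 2) ^ 2) -
          (riemannZetaZeroOrder (ρ : ℂ) : ℂ) *
            ((Complex.cosh (((ρ : ℂ) - 1 / 2) * ((Real.log m - Real.log m' : ℝ) : ℂ)) - 1) /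
              ((ρ : ℂ) - 1 / 2) ^ 2)))
      (((x m * x m' : ℝ) : ℂ) * (zetaScrewKernel (Real.log m) (Real.log m') : ℂ)) := by
    intro m m'
    have h := ((hser (Real.log m)).add (hser (Real.log m'))).sub (hser (Real.log m - Real.log m'))
    have h' := h.mul_left ((x m * x m' : ℝ) : ℂ)
    rw [zetaScrewKernel_def]
    push_cast at h' ⊢
    exact h'
  have hsum := hasSum_sum (s := s) fun m (_ : m ∈ s) =>
    hasSum_sum (s := s) fun m' (_ : m' ∈ s) => hpair m m'
  convert hsum using 1
  · funext ρ
    exact neg_mul_screwSide_eq_sum_sum s hs x _ _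
  · push_cast
    exact Finset.sum_congr rfl fun m _ => Finset.sum_congr rfl fun m' _ => by ring

end Summit.RiemannHypothesis.RiemannHypothesis.Theorems.IntegerScrew

end
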